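import Literature.InformationTheory.QuantumCodes.IntegerProgrammingBoundAdditive
import HarnessLib

/-!
# Branch-and-bound infeasibility certificates for the CRSS linear program with integrality (checker + soundness)

Venture QEC (cell `qec`, LADDER-QEC rung X1 «LP/shadow upper bounds per (n,k) — make "optimal" precise»; row 06).
`Literature/InformationTheory/QuantumCodes/IntegerProgrammingBoundAdditive.lean` types CRSS's system (16)–(21) WITH
INTEGRALITY as `CRSSIntFeasible n k d` (unknowns `A_j, B_j, W_j ∈ ℕ` = weight distributions of `C`, `C⊥`, `(C′)⊥`) and
PROVES that every additive code solves it [CalderbankEtAl1998, §7 Thm. 21 and example (i) after Thm. 22: «The condition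
that the weight distribution of `(C′)⊥` be integral implies certain congruence conditions …»]. This file is OUR side: a
kernel-checkable certificate that the INTEGER system has no solution — a branch-and-bound tree whose internal nodes split
on an integer linear form `c·(A,B,W) ≤ v ∨ c·(A,B,W) ≥ v + 1` (valid because the unknowns are natural numbers and `c` is
integral: this is where integrality enters — the two half-spaces miss the open slab `v < c·x < v+1`, exactly the
«congruence conditions» of CRSS (i)) and whose leaves carry integer Farkas multipliers refuting the accumulated linear
system (weak duality, as in `LPCertificate.lean`). `IPTree.check n k d e t = true` (pure, `decide`-able, tier KERNEL)
for both parity branches `e = 0, 1` gives `¬ CRSSIntFeasible n k d` (`not_crssIntFeasible_of_check`), whence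
nonexistence theorems via the PROVED bridges `not_additiveCodeExists_succ_int` /
`not_additiveCodeExists_zero_of_not_crssIntFeasible`. Exactly the standard certificate format of exact MIP
(branch-and-bound with split disjunctions and dual-ray leaves); the generator is the cell's exact-rational lattice
branch-and-bound `census/type-06/ip/bnb2.py` (HNF of the integrality rows finds the splitting forms). A worked instance
closes the file: `(n,k,d) = (7,0,4)` — CRSS Table III `(7,0) = 3β` — ONE split (`W_1 ≤ 1 ∨ W_1 ≥ 2`; on the affine hull
of the equalities `W_1 = 7/4`) and three Farkas leaves, so `¬ AdditiveCodeExists 7 0 4` UNCONDITIONALLY: the first `β`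
cell of the table as a kernel theorem. HONEST FRAMING: nonexistence only (an upper bound on `d`); nothing here certifies
a distance of a code; the other `β` cells land as DATA files `Census/IPBounds/…`.

References: [CalderbankEtAl1998, §7 (printed pp. 26–28)]; [MacWilliamsSloane1977, Ch. 17 §4 Thm. 20] (dual vectors
as certificates); W. Cook, T. Koch, D. E. Steffy, K. Wolter, *A hybrid branch-and-bound approach for exact rational
mixed-integer programming*, Math. Prog. Comp. 5 (2013) 305–344 (branch-and-bound trees with dual-ray leaves as
certificates of integer infeasibility) [folklore form used here].
-/

namespace Summit.Ventures.QEC.Census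

open Finset Literature.InformationTheory.QuantumCodes

/-! ### Rows: integer linear constraints on `(A, B, W)` -/

/-- One integer linear constraint on the unknowns `A_0..A_n, B_0..B_n, W_0..W_n`:
`Σ_{j≤n} (a_j A_j + b_j B_j + w_j W_j) = rhs` (`eq = true`) or `≥ rhs` (`eq = false`). Column: definition (ours).
[cite: CalderbankEtAl1998, §7 Thm. 21 eqs. (16)–(21)] -/
structure IPRow where
  /-- coefficient of `A_j` -/
  a : ℕ → ℤ
  /-- coefficient of `B_j` -/
  b : ℕ → ℤ
  /-- coefficient of `W_j` -/
  w : ℕ → ℤ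
  /-- right-hand side -/
  rhs : ℤ
  /-- equality (`true`) or `≥` (`false`) -/
  eq : Bool

namespace IPRow

/-- The left-hand side `Σ_{j ≤ n} (a_j A_j + b_j B_j + w_j W_j)`. [cite: CalderbankEtAl1998, §7 Thm. 21] -/
def eval (n : ℕ) (r : IPRow) (A B W : ℕ → ℕ) : ℤ :=
  ∑ j ∈ range (n + 1), (r.a j * A j + r.b j * B j + r.w j * W j)

/-- The row holds at `(A,B,W)`. [cite: CalderbankEtAl1998, §7 Thm. 21] -/
def Sat (n : ℕ) (r : IPRow) (A B W : ℕ → ℕ) : Prop :=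
  if r.eq then r.eval n A B W = r.rhs else r.rhs ≤ r.eval n A B W

/-- A satisfied row contributes a nonnegative amount `y (eval − rhs)` for any admissible multiplier (`y ≥ 0` unless
the row is an equality). [cite: MacWilliamsSloane1977, Ch. 17 §4 Thm. 20] -/
theorem mul_rhs_le {n : ℕ} {r : IPRow} {A B W : ℕ → ℕ} (h : r.Sat n A B W) {y : ℤ} (hy : r.eq = true ∨ 0 ≤ y) :
    y * r.rhs ≤ y * r.eval n A B W := by
  unfold Sat at h
  rcases hy with hy | hy
  · rw [hy] at h; simp only [↓reduceIte] at h; rw [h]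
  · by_cases he : r.eq = true
    · rw [he] at h; simp only [↓reduceIte] at h; rw [h]
    · simp only [he, Bool.false_eq_true, ↓reduceIte] at h
      exact mul_le_mul_of_nonneg_left h hy

end IPRow

/-! ### The base rows of `CRSSIntFeasible n k d` in parity branch `e` -/

/-- Indicator coefficient vector `[j = i] · c`. [folklore] -/
def ind (i : ℕ) (c : ℤ) (j : ℕ) : ℤ := if j = i then c else 0

/-- The rows of CRSS's integer system in parity branch `e ∈ {0,1}` (`[C : C′] = 2^e`), in a fixed order:
`A_0 = 1`; `A_1 = 0`; `Σ A_j = 2^{n−k}`; `2^e Σ_{even} A_j = 2^{n−k}`; for `j ≤ n`: `2^{n−k} B_j − Σ_r P_j(r,n) A_r = 0`;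
for `j ≤ n`: `2^{n−k} W_j − 2^e Σ_{r even} P_j(r,n) A_r = 0`; for `j < d`: `A_j − B_j = 0`; for `j ≤ n`: `B_j − A_j ≥ 0`;
for `j ≤ n`: `W_j − B_j ≥ 0`; and if `k = 0`, for `1 ≤ j < d`: `A_j = 0`. Column: definition (ours).
[cite: CalderbankEtAl1998, §7 Thm. 21 eqs. (16)–(21) and example (i) after Thm. 22 (printed pp. 26–28)] -/
def baseRows (n k d e : ℕ) : List IPRow :=
  [⟨ind 0 1, fun _ => 0, fun _ => 0, 1, true⟩,
   ⟨ind 1 1, fun _ => 0, fun _ => 0, 0, true⟩,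
   ⟨fun _ => 1, fun _ => 0, fun _ => 0, 2 ^ (n - k), true⟩,
   ⟨fun j => if Even j then 2 ^ e else 0, fun _ => 0, fun _ => 0, 2 ^ (n - k), true⟩] ++
  (List.range (n + 1)).map (fun j => ⟨fun r => -krawtchouk4 n j r, ind j (2 ^ (n - k)), fun _ => 0, 0, true⟩) ++
  (List.range (n + 1)).map (fun j =>
    ⟨fun r => if Even r then -(2 ^ e * krawtchouk4 n j r) else 0, fun _ => 0, ind j (2 ^ (n - k)), 0, true⟩) ++
  (List.range d).map (fun j => ⟨ind j 1, ind j (-1), fun _ => 0, 0, true⟩) ++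
  (List.range (n + 1)).map (fun j => ⟨ind j (-1), ind j 1, fun _ => 0, 0, false⟩) ++
  (List.range (n + 1)).map (fun j => ⟨fun _ => 0, ind j (-1), ind j 1, 0, false⟩) ++
  (if k = 0 then (List.range d).filterMap (fun j => if 1 ≤ j then some ⟨ind j 1, fun _ => 0, fun _ => 0, 0, true⟩
    else none) else [])

/-! ### Certificates: branch-and-bound trees with Farkas leaves -/

/-- A **branch-and-bound certificate**: a `leaf` carries integer multipliers (one per row, in row order: base rows,
then the split rows along the path); a `split` node carries an integer linear form (coefficient lists `ca, cb, cw` of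
`A_j, B_j, W_j`, missing entries `0`) and `v : ℤ`, with sub-certificates for `form ≤ v` and for `form ≥ v + 1`.
Column: definition (ours). [cite: MacWilliamsSloane1977, Ch. 17 §4 Thm. 20] -/
inductive IPTree where
  /-- Farkas multipliers refuting the accumulated rows -/
  | leaf (mult : List ℤ) : IPTree
  /-- split on `Σ (ca_j A_j + cb_j B_j + cw_j W_j) ≤ v` (left) `∨ ≥ v + 1` (right) -/
  | split (ca cb cw : List ℤ) (v : ℤ) (le ge : IPTree) : IPTree

/-- Combined coefficient of `A_j`: `Σ_rows y_r a_{r,j}` (recursion on the row/multiplier lists; surplus entries ignored).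
[cite: MacWilliamsSloane1977, Ch. 17 §4 Thm. 20] -/
def combA : List IPRow → List ℤ → ℕ → ℤ
  | r :: rs, y :: ys, j => y * r.a j + combA rs ys j
  | _, _, _ => 0

/-- Combined coefficient of `B_j`. [cite: MacWilliamsSloane1977, Ch. 17 §4 Thm. 20] -/
def combB : List IPRow → List ℤ → ℕ → ℤ
  | r :: rs, y :: ys, j => y * r.b j + combB rs ys j
  | _, _, _ => 0

/-- Combined coefficient of `W_j`. [cite: MacWilliamsSloane1977, Ch. 17 §4 Thm. 20] -/
def combW : List IPRow → List ℤ → ℕ → ℤ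
  | r :: rs, y :: ys, j => y * r.w j + combW rs ys j
  | _, _, _ => 0

/-- Combined right-hand side `Σ_rows y_r rhs_r`. [cite: MacWilliamsSloane1977, Ch. 17 §4 Thm. 20] -/
def combRhs : List IPRow → List ℤ → ℤ
  | r :: rs, y :: ys => y * r.rhs + combRhs rs ys
  | _, _ => 0

/-- Sign conditions: a multiplier of a `≥`-row is `≥ 0`; the two lists have the same length.
[cite: MacWilliamsSloane1977, Ch. 17 §4 Thm. 20] -/
def signsOK : List IPRow → List ℤ → Bool
  | r :: rs, y :: ys => (r.eq || decide (0 ≤ y)) && signsOK rs ys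
  | [], [] => true
  | _, _ => false

/-- **Leaf check** (Farkas): signs admissible, every combined coefficient `≤ 0`, combined right-hand side `> 0`.
[cite: MacWilliamsSloane1977, Ch. 17 §4 Thm. 20] -/
def leafOK (n : ℕ) (rows : List IPRow) (mult : List ℤ) : Bool :=
  signsOK rows mult &&
  ((List.range (n + 1)).all fun j =>
    decide (combA rows mult j ≤ 0) && decide (combB rows mult j ≤ 0) && decide (combW rows mult j ≤ 0)) &&
  decide (0 < combRhs rows mult)

/-- The row `Σ (ca_j A_j + cb_j B_j + cw_j W_j) ≥ v` of a split (coefficient lists, missing entries `0`). [folklore] -/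
def splitRow (ca cb cw : List ℤ) (v : ℤ) : IPRow :=
  ⟨fun j => ca.getD j 0, fun j => cb.getD j 0, fun j => cw.getD j 0, v, false⟩

/-- The opposite row `Σ (−ca_j A_j − cb_j B_j − cw_j W_j) ≥ −v`, i.e. `form ≤ v`. [folklore] -/
def splitRowNeg (ca cb cw : List ℤ) (v : ℤ) : IPRow :=
  ⟨fun j => -ca.getD j 0, fun j => -cb.getD j 0, fun j => -cw.getD j 0, -v, false⟩

/-- **The certificate checker** (pure, `decide`-able): leaves by `leafOK`; a split appends `form ≤ v` on the left and
`form ≥ v + 1` on the right. Column: definition (ours). [cite: MacWilliamsSloane1977, Ch. 17 §4 Thm. 20] -/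
def IPTree.checkRows (n : ℕ) : IPTree → List IPRow → Bool
  | .leaf mult, rows => leafOK n rows mult
  | .split ca cb cw v le ge, rows =>
    le.checkRows n (rows ++ [splitRowNeg ca cb cw v]) && ge.checkRows n (rows ++ [splitRow ca cb cw (v + 1)])

/-- The checker for CRSS's integer system `(n,k,d)` in parity branch `e`. Column: definition (ours).
[cite: CalderbankEtAl1998, §7 Thm. 21 and example (i) after Thm. 22] -/
def IPTree.check (n k d e : ℕ) (t : IPTree) : Bool := t.checkRows n (baseRows n k d e)

/-! ### Soundness: weak duality at the leaves, integrality at the splits -/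

section Soundness

variable {n : ℕ} {A B W : ℕ → ℕ}

/-- The multiplier-weighted sum of the left-hand sides, regrouped by unknown.
[cite: MacWilliamsSloane1977, Ch. 17 §4 Thm. 20] -/
theorem sum_comb_eq (rows : List IPRow) (mult : List ℤ) (A B W : ℕ → ℕ) :
    ∑ j ∈ range (n + 1), (combA rows mult j * A j + combB rows mult j * B j + combW rows mult j * W j) =
      (List.zipWith (fun r y => y * r.eval n A B W) rows mult).sum := by
  induction rows generalizing mult with
  | nil => cases mult <;> simp [combA, combB, combW]
  | cons r rs ih =>
    cases mult with
    | nil => simp [combA, combB, combW]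
    | cons y ys =>
      rw [List.zipWith_cons_cons, List.sum_cons, ← ih ys]
      simp only [IPRow.eval, Finset.mul_sum, ← Finset.sum_add_distrib, combA, combB, combW]
      refine Finset.sum_congr rfl fun j _ => ?_
      ring

/-- If every row holds and the signs are admissible, then `Σ y_r rhs_r ≤ Σ_j (combA_j A_j + combB_j B_j + combW_j W_j)`.
[cite: MacWilliamsSloane1977, Ch. 17 §4 Thm. 20] -/
theorem combRhs_le (rows : List IPRow) (mult : List ℤ) (hs : signsOK rows mult = true)
    (hsat : ∀ r ∈ rows, r.Sat n A B W) :
    combRhs rows mult ≤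
      ∑ j ∈ range (n + 1), (combA rows mult j * A j + combB rows mult j * B j + combW rows mult j * W j) := by
  rw [sum_comb_eq]
  induction rows generalizing mult with
  | nil => cases mult <;> simp [combRhs]
  | cons r rs ih =>
    cases mult with
    | nil => simp [signsOK] at hs
    | cons y ys =>
      simp only [signsOK, Bool.and_eq_true, Bool.or_eq_true, decide_eq_true_eq] at hs
      simp only [combRhs, List.zipWith_cons_cons, List.sum_cons]
      have h1 := IPRow.mul_rhs_le (hsat r (by simp)) hs.1
      have h2 := ih ys hs.2 (fun r' hr' => hsat r' (List.mem_cons_of_mem _ hr'))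
      linarith

/-- **Weak duality**: a leaf that checks refutes its rows. [cite: MacWilliamsSloane1977, Ch. 17 §4 Thm. 20] -/
theorem not_sat_of_leafOK {rows : List IPRow} {mult : List ℤ} (h : leafOK n rows mult = true)
    (hsat : ∀ r ∈ rows, r.Sat n A B W) : False := by
  simp only [leafOK, Bool.and_eq_true, List.all_eq_true, List.mem_range, decide_eq_true_eq] at h
  obtain ⟨⟨hs, hc⟩, hrhs⟩ := h
  have hle := combRhs_le rows mult hs hsat
  have hnonpos : ∑ j ∈ range (n + 1),
      (combA rows mult j * A j + combB rows mult j * B j + combW rows mult j * W j) ≤ 0 := by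
    refine Finset.sum_nonpos fun j hj => ?_
    obtain ⟨⟨ha, hb⟩, hw⟩ := hc j (by simpa using hj)
    have hA : (0 : ℤ) ≤ A j := Nat.cast_nonneg _
    have hB : (0 : ℤ) ≤ B j := Nat.cast_nonneg _
    have hW : (0 : ℤ) ≤ W j := Nat.cast_nonneg _
    nlinarith
  linarith

/-- The value of a split form is an integer, so it is `≤ v` or `≥ v + 1`: one of the two appended rows holds.
[folklore (integrality ⇒ split disjunction)] -/
theorem sat_split_or (ca cb cw : List ℤ) (v : ℤ) (A B W : ℕ → ℕ) :
    (splitRowNeg ca cb cw v).Sat n A B W ∨ (splitRow ca cb cw (v + 1)).Sat n A B W := by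
  set s : ℤ := ∑ j ∈ range (n + 1), (ca.getD j 0 * A j + cb.getD j 0 * B j + cw.getD j 0 * W j) with hs
  have hneg : (splitRowNeg ca cb cw v).eval n A B W = -s := by
    simp only [IPRow.eval, splitRowNeg, hs, ← Finset.sum_neg_distrib]
    refine Finset.sum_congr rfl fun j _ => ?_
    ring
  have hpos : (splitRow ca cb cw (v + 1)).eval n A B W = s := by
    simp only [IPRow.eval, splitRow, hs]
  rcases le_or_gt s v with h | h
  · left
    simp only [IPRow.Sat, splitRowNeg, Bool.false_eq_true, ↓reduceIte]
    rw [show (⟨fun j => -ca.getD j 0, fun j => -cb.getD j 0, fun j => -cw.getD j 0, -v, false⟩ : IPRow).eval n A B W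
      = -s from hneg]
    linarith
  · right
    simp only [IPRow.Sat, splitRow, Bool.false_eq_true, ↓reduceIte]
    rw [show (⟨fun j => ca.getD j 0, fun j => cb.getD j 0, fun j => cw.getD j 0, v + 1, false⟩ : IPRow).eval n A B W
      = s from hpos]
    omega

/-- **Soundness of the tree checker**: a certificate that checks refutes its rows at every `(A,B,W) : ℕ → ℕ`.
Column: proved (ours). [cite: MacWilliamsSloane1977, Ch. 17 §4 Thm. 20] -/
theorem not_sat_of_checkRows (t : IPTree) {rows : List IPRow} (h : t.checkRows n rows = true)
    (hsat : ∀ r ∈ rows, r.Sat n A B W) : False := by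
  induction t generalizing rows with
  | leaf mult => exact not_sat_of_leafOK h hsat
  | split ca cb cw v le ge ihl ihg =>
    simp only [IPTree.checkRows, Bool.and_eq_true] at h
    rcases sat_split_or ca cb cw v A B W with hl | hg
    · refine ihl h.1 fun r hr => ?_
      rcases List.mem_append.1 hr with hr | hr
      · exact hsat r hr
      · rw [List.mem_singleton.1 hr]; exact hl
    · refine ihg h.2 fun r hr => ?_
      rcases List.mem_append.1 hr with hr | hr
      · exact hsat r hr
      · rw [List.mem_singleton.1 hr]; exact hg

/-! ### The base rows hold at every solution of `CRSSIntFeasible` -/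

/-- `Σ_{j ≤ n} [j = i] c · x_j = c · x_i` for `i ≤ n`, and `0` otherwise. [folklore] -/
theorem sum_ind_mul (i : ℕ) (c : ℤ) (x : ℕ → ℕ) :
    ∑ j ∈ range (n + 1), ind i c j * x j = if i ≤ n then c * x i else 0 := by
  simp only [ind, ite_mul, zero_mul, Finset.sum_ite_eq', mem_range, Nat.lt_succ_iff]

/-- Every base row of branch `e` holds at a solution `(A,B,W,e)` of the integer system.
[cite: CalderbankEtAl1998, §7 Thm. 21 eqs. (16)–(21)] -/
theorem sat_baseRows {k d e : ℕ} (h0 : A 0 = 1) (h1 : A 1 = 0)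
    (hsum : ∑ j ∈ range (n + 1), A j = 2 ^ (n - k))
    (hpar : 2 ^ e * ∑ j ∈ (range (n + 1)).filter Even, A j = 2 ^ (n - k))
    (hB : ∀ j, j ≤ n → (2 : ℤ) ^ (n - k) * B j = ∑ r ∈ range (n + 1), krawtchouk4 n j r * A r)
    (hW : ∀ j, j ≤ n →
      (2 : ℤ) ^ (n - k) * W j = 2 ^ e * ∑ r ∈ (range (n + 1)).filter Even, krawtchouk4 n j r * A r)
    (heq : ∀ j, j < d → A j = B j) (hle : ∀ j, j ≤ n → A j ≤ B j) (hBW : ∀ j, j ≤ n → B j ≤ W j)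
    (hpure : k = 0 → ∀ j, 1 ≤ j → j < d → A j = 0) :
    ∀ r ∈ baseRows n k d e, r.Sat n A B W := by
  intro r hr
  simp only [baseRows, List.append_assoc, List.mem_append, List.mem_cons, List.not_mem_nil, or_false, List.mem_map,
    List.mem_range] at hr
  rcases hr with (hr | hr | hr | hr) | ⟨j, hj, rfl⟩ | ⟨j, hj, rfl⟩ | ⟨j, hj, rfl⟩ | ⟨j, hj, rfl⟩ | ⟨j, hj, rfl⟩ | hr
  · -- A_0 = 1
    subst hr
    simp only [IPRow.Sat, ↓reduceIte, IPRow.eval, zero_mul, add_zero, sum_ind_mul, zero_le, h0]; simp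
  · -- A_1 = 0
    subst hr
    simp only [IPRow.Sat, ↓reduceIte, IPRow.eval, zero_mul, add_zero, sum_ind_mul, h1]
    split_ifs <;> simp
  · -- Σ A_j = 2^{n-k}
    subst hr
    simp only [IPRow.Sat, ↓reduceIte, IPRow.eval, zero_mul, add_zero, one_mul]
    exact_mod_cast hsum
  · -- parity
    subst hr
    simp only [IPRow.Sat, ↓reduceIte, IPRow.eval, zero_mul, add_zero, ite_mul, Finset.sum_ite, Finset.sum_const_zero,
      ← Finset.mul_sum]
    exact_mod_cast hpar
  · -- 2^{n-k} B_j - Σ P A = 0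
    have hjn : j ≤ n := by omega
    simp only [IPRow.Sat, ↓reduceIte, IPRow.eval, zero_mul, add_zero, Finset.sum_add_distrib, sum_ind_mul, if_pos hjn,
      neg_mul, Finset.sum_neg_distrib, hB j hjn]
    ring
  · -- 2^{n-k} W_j - 2^e Σ_even P A = 0
    have hjn : j ≤ n := by omega
    simp only [IPRow.Sat, ↓reduceIte, IPRow.eval, zero_mul, add_zero, Finset.sum_add_distrib, sum_ind_mul,
      if_pos hjn, hW j hjn, ite_mul, Finset.sum_ite, Finset.sum_const_zero, neg_mul, Finset.sum_neg_distrib,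
      Finset.mul_sum]
    ring
  · -- A_j - B_j = 0, j < d
    simp only [IPRow.Sat, ↓reduceIte, IPRow.eval, zero_mul, add_zero, Finset.sum_add_distrib, sum_ind_mul]
    split_ifs with hjn
    · rw [heq j hj]; ring
    · simp
  · -- B_j - A_j ≥ 0
    have hjn : j ≤ n := by omega
    simp only [IPRow.Sat, Bool.false_eq_true, ↓reduceIte, IPRow.eval, zero_mul, add_zero, Finset.sum_add_distrib,
      sum_ind_mul, if_pos hjn]
    have := hle j hjn
    linarith [(by exact_mod_cast this : (A j : ℤ) ≤ B j)]
  · -- W_j - B_j ≥ 0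
    have hjn : j ≤ n := by omega
    simp only [IPRow.Sat, Bool.false_eq_true, ↓reduceIte, IPRow.eval, zero_mul, zero_add, Finset.sum_add_distrib,
      sum_ind_mul, if_pos hjn]
    have := hBW j hjn
    linarith [(by exact_mod_cast this : (B j : ℤ) ≤ W j)]
  · -- purity rows (k = 0)
    split_ifs at hr with hk
    · simp only [List.mem_filterMap, List.mem_range] at hr
      obtain ⟨j, hjd, hj⟩ := hr
      split_ifs at hj with hj1
      simp only [Option.some.injEq] at hj
      subst hj
      simp only [IPRow.Sat, ↓reduceIte, IPRow.eval, zero_mul, add_zero, sum_ind_mul, hpure hk j hj1 hjd]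
      split_ifs <;> simp
    · simp at hr

/-- **Two checked certificates (one per parity branch) refute CRSS's integer system** — UNCONDITIONAL (weak duality
and integrality only). Column: proved (ours).
[cite: CalderbankEtAl1998, §7 (after Thm. 22: «if … no feasible solution exists … no [[n,k,d]] code exists») and example (i)] -/
theorem not_crssIntFeasible_of_check {k d : ℕ} (t₀ t₁ : IPTree) (h₀ : t₀.check n k d 0 = true)
    (h₁ : t₁.check n k d 1 = true) : ¬ CRSSIntFeasible n k d := by
  rintro ⟨A, B, W, e, he1, h0, h1, hsum, hpar, hB, hW, heq, hle, hBW, hpure⟩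
  have hsat := sat_baseRows (n := n) h0 h1 hsum hpar hB hW heq hle hBW hpure
  interval_cases e
  · exact not_sat_of_checkRows t₀ h₀ hsat
  · exact not_sat_of_checkRows t₁ h₁ hsat

end Soundness

/-! ### A worked instance: no `[[7,0,4]]` — CRSS Table III `(7,0) = 3β`, the first special upper bound as a kernel theorem -/

section Instance

/-- Certificate, branch `e = 0` (`C` even): the equalities are already inconsistent over `ℚ` (one Farkas leaf). (data) -/
def ipcert_7_0_4_e0 : IPTree :=
  .leaf [1664, 0, -21, 16, 0, 7, 3, 1, 0, 0, 0, 0, 0, 0, 0, 0, 0, 0, 0, 0, 0, 896, 384, 128, 0, 0, 0, 0, 0, 0, 0, 0, 0, 0, 0, 0, 0, 0, 0, 0, 0, 0, 0]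

/-- Certificate, branch `e = 1`: split `W_1 ≤ 1 ∨ W_1 ≥ 2` (on the affine hull of the equalities `W_1 = 7/4` —
«the weight distribution of `(C′)⊥` must be integral»), two Farkas leaves. (data) -/
def ipcert_7_0_4_e1 : IPTree :=
  .split [] [] [0, 1] 1
  (
    .leaf [-192, 320, 7, -2, 0, -4, -1, 0, 0, 0, 0, 0, 0, 2, 0, 0, 0, 0, 0, 0, 0, -512, -128, 0, 0, 0, 0, 0, 0, 0, 0, 0, 0, 0, 0, 0, 0, 0, 0, 0, 0, 64, -64, 256])
  (
    .leaf [192, -320, -7, 2, 0, 4, 1, 0, 0, 0, 0, 0, 0, -2, 0, 0, 0, 0, 0, 0, 0, 512, 128, 0, 0, 0, 0, 0, 0, 0, 0, 0, 0, 0, 0, 0, 0, 0, 0, 0, 0, -64, 64, 256])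

/-- The two certificates check. (proved, KERNEL: `decide +kernel`) -/
theorem check_ipcert_7_0_4 :
    ipcert_7_0_4_e0.check 7 0 4 0 = true ∧ ipcert_7_0_4_e1.check 7 0 4 1 = true := by
  constructor <;> decide +kernel

/-- CRSS's INTEGER system is infeasible at `(n,k,d) = (7,0,4)`. (proved, KERNEL, unconditional)
[cite: CalderbankEtAl1998, §7 (iii) («Similar arguments eliminate the parameters [[7,0,4]] …», printed p. 28)] -/
theorem not_crssIntFeasible_7_0_4 : ¬ CRSSIntFeasible 7 0 4 :=
  not_crssIntFeasible_of_check _ _ check_ipcert_7_0_4.1 check_ipcert_7_0_4.2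

/-- **No `[[7,0,4]]` additive code** — CRSS Table III entry `(7,0) = 3β` (special upper bound) as an UNCONDITIONAL
kernel theorem (the LP alone gives only `d ≤ 4`, `NoCode.noCode_7_0`). (proved, KERNEL, unconditional)
[cite: CalderbankEtAl1998, §7 (iii) (printed p. 28) and §8 Table III entry (7,0) (printed p. 32)] -/
theorem noCodeBeta_7_0 : ¬ AdditiveCodeExists 7 0 4 :=
  not_additiveCodeExists_zero_of_not_crssIntFeasible (by norm_num) not_crssIntFeasible_7_0_4

end Instance

end Summit.Ventures.QEC.Census
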